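import Literature.NumberTheory.LFunctions.WeilLineSupSamplingPrelim
import Literature.NumberTheory.LFunctions.WeilExplicitProofs
import Literature.NumberTheory.LFunctions.WeilArchimedeanPositivityProofs
import Literature.NumberTheory.LFunctions.WeilLineZerosDensity
import HarnessLib

/-!
# Duffin–Schaeffer's sup-norm sampling inequality on sequences of uniform density

**Theorem** (`exists_norm_weilMellin_line_le_mul_of_uniformDensity`; Duffin–Schaeffer 1945,
Lemma IV of Duffin–Schaeffer 1952; Beurling). Fix `d > 0`, `s > 0`, `M` and a window
`0 < b < π d`. There is a constant `K` such that for every real sequence `λ : ℤ → ℝ` of uniform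
density `d` (`|λ_n - n/d| ≤ M`, `|λ_m - λ_n| ≥ s` for `m ≠ n`) and every Weil test function `G`
supported in `[-b, b]`,

  `sup_{x ∈ ℝ} |Ĝ(1/2 + ix)| ≤ K · sup_n |Ĝ(1/2 + iλ_n)|`

(stated as: `|Ĝ(1/2+iλ_n)| ≤ B` for all `n` implies `|Ĝ(1/2+ix)| ≤ K B` for all `x`), where
`Ĝ = weilMellin G`, `Ĝ(1/2 + ix) = ∫ G(u) e^{ixu} du`.

Proof (Beurling's compactness argument, in Weil vocabulary). If no `K` works, the
normalisation step `exists_normalised_window_of_lt` (normalise by `S = sup_ℝ |Ĝ(1/2+i·)|`,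
modulate so that a near-maximum sits at `1/2`, re-index the sequence, mollify with a fixed bump
`φ` supported in `[-η, η]`, `3η = πd - b`) produces Weil tests `W_k` supported in
`[-(b+η), b+η]` with `|Ŵ_k(1/2+iy)| ≤ |φ̂(1/2+iy)|`, `|Ŵ_k(1/2)| ≥ |φ̂(1/2)|/2 > 0`, and
`|Ŵ_k(1/2+iλ^k_n)| ≤ C/(k+1)` on sequences `λ^k` of a fixed class. By Fourier inversion the
`W_k` are uniformly bounded and uniformly Lipschitz (`WeilLineSupSamplingPrelim`), so a
subsequence converges pointwise to a continuous `V` supported in `[-(b+η), b+η]` while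
`λ^k_n → μ_n` coordinatewise
(`exists_subseq_tendsto_of_bounded_lipschitz`); dominated convergence gives `Ŵ_k → V̂` on the
critical line, whence `V̂(1/2 + iμ_n) = 0` for the injective sequence `μ` of uniform density `d`
and `V̂(1/2) ≠ 0` — contradicting the density theorem
`WeilLineZerosDensity.weilMellin_half_eq_zero_of_zeros_uniformDensity` (`b + η < π d`).
Everything is proved; no definitions, no named facts.
-/

noncomputable section

open Complex Set MeasureTheory Filter Metric
open scoped Real Topology Pointwise

namespace Literature.NumberTheory.LFunctions

/-! ### The normalisation step -/

variable {g : ℝ → ℂ}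

/-- `‖ĝ(1/2 + iy)‖ ≤ ∫ ‖g‖` for `g` continuous of compact support. [folklore] -/
theorem norm_weilMellin_line_le_integral_norm (hg : Continuous g) (hg' : HasCompactSupport g)
    (y : ℝ) : ‖weilMellin g (1 / 2 + y * I)‖ ≤ ∫ t, ‖g t‖ := by
  have h := norm_weilMellin_le_weilL1W hg hg' (A := 0) (s := 1 / 2 + y * I) (by simp)
  simpa [weilL1W] using h

/-- The transform of a window is bounded along the critical line. [folklore] -/
theorem bddAbove_range_norm_weilMellin_line (hg : Continuous g) (hg' : HasCompactSupport g) :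
    BddAbove (Set.range fun y : ℝ => ‖weilMellin g (1 / 2 + y * I)‖) :=
  ⟨∫ t, ‖g t‖, by rintro _ ⟨y, rfl⟩; exact norm_weilMellin_line_le_integral_norm hg hg' y⟩

/-- Re-indexing a sequence of uniform density after a real translation: with `m = ⌊y d⌋`,
`λ'_n = λ_{n+m} - y` satisfies `|λ'_n - n/d| ≤ M + 1/d`. [folklore] -/
theorem abs_shift_sub_index_le {Λ : ℤ → ℝ} {d M : ℝ} (hd : 0 < d) (hΛ : ∀ n, |Λ n - n / d| ≤ M)
    (y : ℝ) (n : ℤ) : |(Λ (n + ⌊y * d⌋) - y) - n / d| ≤ M + 1 / d := by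
  set m : ℤ := ⌊y * d⌋ with hm
  have h1 := hΛ (n + m)
  have h2 : |(m : ℝ) / d - y| ≤ 1 / d := by
    have hf1 : (m : ℝ) ≤ y * d := Int.floor_le _
    have hf2 : y * d < m + 1 := Int.lt_floor_add_one _
    have e : (m : ℝ) / d - y = (m - y * d) / d := by field_simp
    rw [e, abs_div, abs_of_pos hd, div_le_div_iff_of_pos_right hd, abs_le]
    constructor <;> linarith
  calc |(Λ (n + m) - y) - n / d| = |(Λ (n + m) - (n + m : ℤ) / d) + ((m : ℝ) / d - y)| := by
        push_cast; ring_nf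
    _ ≤ |Λ (n + m) - (n + m : ℤ) / d| + |(m : ℝ) / d - y| := abs_add_le _ _
    _ ≤ M + 1 / d := add_le_add h1 h2

/-- `[-b, b] + [-η, η] ⊆ [-(b+η), b+η]`. [folklore] -/
theorem Icc_add_Icc_subset_symm (b η : ℝ) :
    Icc (-b) b + Icc (-η) η ⊆ Icc (-(b + η)) (b + η) := by
  rintro _ ⟨u, hu, v, hv, rfl⟩
  simp only [mem_Icc] at hu hv ⊢
  constructor <;> linarith

/-- **The normalisation step.** See the module docstring. [folklore] -/
theorem exists_normalised_window_of_lt {d s b M η K : ℝ} (hd : 0 < d) (hK : 0 < K)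
    {φ : ℝ → ℂ} (hφ : IsWeilTest φ) (hφs : tsupport φ ⊆ Icc (-η) η)
    {Λ : ℤ → ℝ} (hΛ : ∀ n, |Λ n - n / d| ≤ M) (hsep : Pairwise fun m n => s ≤ |Λ m - Λ n|)
    {G : ℝ → ℂ} (hG : IsWeilTest G) (hGs : tsupport G ⊆ Icc (-b) b) {B x₀ : ℝ}
    (hB : ∀ n, ‖weilMellin G (1 / 2 + Λ n * I)‖ ≤ B)
    (hx₀ : K * B < ‖weilMellin G (1 / 2 + x₀ * I)‖) :
    ∃ (Λ' : ℤ → ℝ) (W : ℝ → ℂ), (∀ n, |Λ' n - n / d| ≤ M + 1 / d) ∧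
      (Pairwise fun m n => s ≤ |Λ' m - Λ' n|) ∧ IsWeilTest W ∧
      tsupport W ⊆ Icc (-(b + η)) (b + η) ∧
      (∀ y : ℝ, ‖weilMellin W (1 / 2 + y * I)‖ ≤ ‖weilMellin φ (1 / 2 + y * I)‖) ∧
      (∀ n, ‖weilMellin W (1 / 2 + Λ' n * I)‖ ≤ (∫ t, ‖φ t‖) / K) ∧
      ‖weilMellin φ (1 / 2)‖ / 2 ≤ ‖weilMellin W (1 / 2)‖ := by
  set F : ℝ → ℝ := fun y => ‖weilMellin G (1 / 2 + y * I)‖ with hF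
  have hFbdd : BddAbove (Set.range F) := bddAbove_range_norm_weilMellin_line hG.1.continuous hG.2
  set S : ℝ := ⨆ y, F y with hS
  have hFS : ∀ y, F y ≤ S := fun y => le_ciSup hFbdd y
  have hB0 : 0 ≤ B := (norm_nonneg _).trans (hB 0)
  have hKB : 0 ≤ K * B := mul_nonneg hK.le hB0
  have hSx : K * B < S := hx₀.trans_le (hFS x₀)
  have hS0 : 0 < S := hKB.trans_lt hSx
  -- a near-maximum `y₀`
  obtain ⟨y₀, hy₀⟩ : ∃ y₀, S / 2 < F y₀ := exists_lt_of_lt_ciSup (by linarith)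
  -- normalise and modulate
  set G₁ : ℝ → ℂ := fun t => ((S⁻¹ : ℝ) : ℂ) * (G t * cexp ((y₀ * t : ℝ) * I)) with hG₁def
  have hG₁ : IsWeilTest G₁ := (isWeilTest_mul_cexp_ofReal_mul_I hG y₀).const_mul _
  have hG₁s : tsupport G₁ ⊆ Icc (-b) b :=
    (tsupport_mul_subset_right.trans (tsupport_mul_cexp_subset G y₀)).trans hGs
  have hG₁M : ∀ y : ℝ, weilMellin G₁ (1 / 2 + y * I) =
      ((S⁻¹ : ℝ) : ℂ) * weilMellin G (1 / 2 + ((y + y₀ : ℝ) : ℂ) * I) := by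
    intro y
    rw [hG₁def, weilMellin_const_mul, weilMellin_mul_cexp_ofReal_mul_I_half]
  have hG₁norm : ∀ y : ℝ, ‖weilMellin G₁ (1 / 2 + y * I)‖ = S⁻¹ * F (y + y₀) := by
    intro y
    rw [hG₁M, norm_mul, Complex.norm_real, Real.norm_of_nonneg (inv_nonneg.2 hS0.le)]
  have hG₁le : ∀ y : ℝ, ‖weilMellin G₁ (1 / 2 + y * I)‖ ≤ 1 := by
    intro y
    rw [hG₁norm, inv_mul_le_iff₀ hS0, mul_one]
    exact hFS _
  have hG₁zero : 1 / 2 < ‖weilMellin G₁ (1 / 2 + (0 : ℝ) * I)‖ := by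
    rw [hG₁norm, zero_add, lt_inv_mul_iff₀ hS0]
    linarith
  -- the shifted sequence
  set m : ℤ := ⌊y₀ * d⌋ with hm
  set Λ' : ℤ → ℝ := fun n => Λ (n + m) - y₀ with hΛ'
  have hΛ'M : ∀ n, |Λ' n - n / d| ≤ M + 1 / d := fun n => abs_shift_sub_index_le hd hΛ y₀ n
  have hΛ'sep : Pairwise fun i j => s ≤ |Λ' i - Λ' j| := by
    intro i j hij
    have h := hsep (show i + m ≠ j + m from fun h => hij (add_right_cancel h))
    simp only [hΛ']
    rwa [show Λ (i + m) - y₀ - (Λ (j + m) - y₀) = Λ (i + m) - Λ (j + m) by ring]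
  have hG₁small : ∀ n, ‖weilMellin G₁ (1 / 2 + Λ' n * I)‖ ≤ K⁻¹ := by
    intro n
    rw [hG₁norm]
    have e : Λ' n + y₀ = Λ (n + m) := by simp only [hΛ']; ring
    rw [e]
    have h1 : F (Λ (n + m)) ≤ B := hB (n + m)
    have h2 : B ≤ S * K⁻¹ := by
      rw [← div_eq_mul_inv, le_div_iff₀ hK]; linarith
    calc S⁻¹ * F (Λ (n + m)) ≤ S⁻¹ * (S * K⁻¹) := by gcongr; exact h1.trans h2
      _ = K⁻¹ := by field_simp
  -- mollify
  set W : ℝ → ℂ := weilConv G₁ φ with hW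
  have hWt : IsWeilTest W := hG₁.weilConv hφ
  have hWs : tsupport W ⊆ Icc (-(b + η)) (b + η) :=
    (tsupport_weilConv_subset hG₁.2).trans ((add_subset_add hG₁s hφs).trans
      (Icc_add_Icc_subset_symm b η))
  have hWM : ∀ z : ℂ, weilMellin W z = weilMellin G₁ z * weilMellin φ z := fun z =>
    weilMellin_weilConv_holds hG₁.1.continuous hG₁.2 hφ.1.continuous hφ.2 z
  refine ⟨Λ', W, hΛ'M, hΛ'sep, hWt, hWs, fun y => ?_, fun n => ?_, ?_⟩
  · rw [hWM, norm_mul]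
    exact mul_le_of_le_one_left (norm_nonneg _) (hG₁le y)
  · rw [hWM, norm_mul]
    calc ‖weilMellin G₁ (1 / 2 + Λ' n * I)‖ * ‖weilMellin φ (1 / 2 + Λ' n * I)‖
        ≤ K⁻¹ * ∫ t, ‖φ t‖ :=
          mul_le_mul (hG₁small n) (norm_weilMellin_line_le_integral_norm hφ.1.continuous hφ.2 _)
            (norm_nonneg _) (inv_nonneg.2 hK.le)
      _ = (∫ t, ‖φ t‖) / K := by rw [div_eq_inv_mul]
  · have hz : 1 / 2 < ‖weilMellin G₁ (1 / 2)‖ := by simpa using hG₁zero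
    rw [hWM (1 / 2), norm_mul]
    nlinarith [hz, norm_nonneg (weilMellin φ (1 / 2))]

/-! ### The compactness argument -/

/-- A nonnegative real bump as a Weil test: supported in `[-η, η]` with `∫ φ ≠ 0`, hence
`φ̂(1/2) ≠ 0`. [folklore] -/
theorem exists_isWeilTest_bump_weilMellin_half_ne_zero {η : ℝ} (hη : 0 < η) :
    ∃ φ : ℝ → ℂ, IsWeilTest φ ∧ tsupport φ ⊆ Icc (-η) η ∧ weilMellin φ (1 / 2) ≠ 0 := by
  let β : ContDiffBump (0 : ℝ) := ⟨η / 2, η, by positivity, by linarith⟩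
  refine ⟨fun t => ((β t : ℝ) : ℂ), ⟨Complex.ofRealCLM.contDiff.comp β.contDiff,
    β.hasCompactSupport.comp_left Complex.ofReal_zero⟩, ?_, ?_⟩
  · refine (tsupport_comp_subset Complex.ofReal_zero _).trans ?_
    rw [β.tsupport_eq, Real.closedBall_eq_Icc, zero_sub, zero_add]
  · unfold weilMellin
    simp only [sub_self, zero_mul, Complex.exp_zero, mul_one, integral_complex_ofReal, ne_eq,
      Complex.ofReal_eq_zero]
    refine (β.continuous.integral_pos_of_hasCompactSupport_nonneg_nonzero β.hasCompactSupport
      (fun x => β.nonneg) (x := 0) ?_).ne'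
    rw [β.one_of_mem_closedBall (Metric.mem_closedBall_self (by positivity))]
    exact one_ne_zero

/-- **Duffin–Schaeffer's sup-norm sampling inequality** for windows shorter than `π d` on real
separated sequences of uniform density `d` (Duffin–Schaeffer 1952, Lemma IV = Duffin–Schaeffer
1945; proof by Beurling's compactness argument and the density theorem for zeros).
[cite: DuffinSchaeffer1952, Lemma IV] -/
theorem exists_norm_weilMellin_line_le_mul_of_uniformDensity {d s b : ℝ} (M : ℝ) (hd : 0 < d)
    (hs : 0 < s) (hb : 0 < b) (hbd : b < π * d) :
    ∃ K : ℝ, 0 < K ∧ ∀ (Λ : ℤ → ℝ), (∀ n, |Λ n - n / d| ≤ M) →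
      (Pairwise fun m n => s ≤ |Λ m - Λ n|) →
      ∀ (G : ℝ → ℂ), IsWeilTest G → tsupport G ⊆ Icc (-b) b →
      ∀ B : ℝ, (∀ n, ‖weilMellin G (1 / 2 + Λ n * I)‖ ≤ B) →
      ∀ x : ℝ, ‖weilMellin G (1 / 2 + x * I)‖ ≤ K * B := by
  by_contra H
  push Not at H
  -- the geometry: `b + η < π d`
  set η : ℝ := (π * d - b) / 3 with hη
  have hη0 : 0 < η := by rw [hη]; linarith
  have hbη : b + η < π * d := by rw [hη]; linarith
  set b' : ℝ := b + η with hb'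
  have hb'0 : 0 < b' := by rw [hb']; linarith
  -- a bump and its constants
  obtain ⟨φ, hφ, hφs, hφ0⟩ := exists_isWeilTest_bump_weilMellin_half_ne_zero hη0
  have e12 : ((1 / 2 : ℝ) : ℂ) = 1 / 2 := by push_cast; ring
  set Φ : ℝ → ℝ := fun y => ‖weilMellin φ (1 / 2 + y * I)‖ with hΦ
  have hΦi : Integrable Φ := by
    have := (integrable_weilMellin_vertical hφ (1 / 2)).norm
    simpa only [e12] using this
  obtain ⟨Ψ, hΨi, hΨ⟩ := exists_integrable_abs_mul_norm_weilMellin_line_le hφ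
  set C₀ : ℝ := (2 * π)⁻¹ * ∫ y, Φ y with hC₀
  set L₀ : ℝ := (2 * π)⁻¹ * ∫ y, Ψ y with hL₀
  set Nφ : ℝ := ∫ t, ‖φ t‖ with hNφ
  -- the sequence of normalised windows
  have hstep : ∀ k : ℕ, ∃ (Λ' : ℤ → ℝ) (W : ℝ → ℂ), (∀ n, |Λ' n - n / d| ≤ M + 1 / d) ∧
      (Pairwise fun m n => s ≤ |Λ' m - Λ' n|) ∧ IsWeilTest W ∧
      tsupport W ⊆ Icc (-b') b' ∧
      (∀ y : ℝ, ‖weilMellin W (1 / 2 + y * I)‖ ≤ ‖weilMellin φ (1 / 2 + y * I)‖) ∧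
      (∀ n, ‖weilMellin W (1 / 2 + Λ' n * I)‖ ≤ Nφ / (k + 1)) ∧
      ‖weilMellin φ (1 / 2)‖ / 2 ≤ ‖weilMellin W (1 / 2)‖ := by
    intro k
    obtain ⟨Λ, hΛ, hsep, G, hG, hGs, B, hB, x₀, hx₀⟩ := H (k + 1) (by positivity)
    exact exists_normalised_window_of_lt hd (by positivity) hφ hφs hΛ hsep hG hGs hB hx₀
  choose Λs Ws hΛsM hΛsep hWt hWsupp hWle hWsmall hWhalf using hstep
  -- uniform bounds
  have hC : ∀ k u, ‖Ws k u‖ ≤ C₀ := fun k u =>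
    norm_le_of_norm_weilMellin_line_le (hWt k) hΦi (hWle k) u
  have hL : ∀ k u v, ‖Ws k u - Ws k v‖ ≤ L₀ * |u - v| := by
    intro k u v
    have h := norm_sub_le_of_norm_weilMellin_line_le (hWt k) hΨi (fun y => ?_) u v
    · rw [hL₀]; linarith [h]
    · exact (mul_le_mul_of_nonneg_left (hWle k y) (abs_nonneg y)).trans (hΨ y)
  have hν : ∀ (k : ℕ) (n : ℤ),
      Λs k n ∈ Icc ((n : ℝ) / d - (M + 1 / d)) ((n : ℝ) / d + (M + 1 / d)) := by
    intro k n
    have := hΛsM k n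
    rw [abs_le] at this
    constructor <;> linarith [this.1, this.2]
  -- extraction
  obtain ⟨ψ, V, μ, hψ, hV, hμ, hμmem⟩ := exists_subseq_tendsto_of_bounded_lipschitz hC hL hν
  -- the limit window `V`
  have hVC : ∀ u, ‖V u‖ ≤ C₀ := fun u =>
    le_of_tendsto' ((hV u).norm) fun k => hC _ u
  have hVL : ∀ u v, ‖V u - V v‖ ≤ L₀ * |u - v| := fun u v =>
    le_of_tendsto' (((hV u).sub (hV v)).norm) fun k => hL _ u v
  have hL00 : 0 ≤ L₀ := by
    have h := hL 0 0 1
    have : (0 : ℝ) ≤ L₀ * |(0 : ℝ) - 1| := (norm_nonneg _).trans h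
    simpa using this
  have hVcont : Continuous V := by
    refine Metric.continuous_iff.2 fun u ε hε => ⟨ε / (L₀ + 1), by positivity, fun v hv => ?_⟩
    rw [dist_eq_norm] at hv ⊢
    calc ‖V v - V u‖ ≤ L₀ * |v - u| := hVL v u
      _ ≤ (L₀ + 1) * |v - u| := by gcongr; linarith
      _ < (L₀ + 1) * (ε / (L₀ + 1)) := by
          refine mul_lt_mul_of_pos_left ?_ (by linarith)
          simpa [Real.dist_eq] using hv
      _ = ε := by field_simp
  have hWzero : ∀ k u, u ∉ Icc (-b') b' → Ws k u = 0 := fun k u hu =>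
    image_eq_zero_of_notMem_tsupport fun h => hu (hWsupp k h)
  have hVzero : ∀ u, u ∉ Icc (-b') b' → V u = 0 := by
    intro u hu
    have h1 : Tendsto (fun k => Ws (ψ k) u) atTop (𝓝 0) := by
      simp only [hWzero _ u hu]; exact tendsto_const_nhds
    exact tendsto_nhds_unique (hV u) h1
  have hVsupp : tsupport V ⊆ Icc (-b') b' :=
    closure_minimal (fun u hu => by_contra fun h => hu (hVzero u h)) isClosed_Icc
  have hVcs : HasCompactSupport V :=
    HasCompactSupport.of_support_subset_isCompact isCompact_Icc
      ((subset_tsupport V).trans hVsupp)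
  -- convergence of the transforms on the critical line
  have hconv : ∀ t : ℝ, Tendsto (fun k => weilMellin (Ws (ψ k)) (1 / 2 + t * I)) atTop
      (𝓝 (weilMellin V (1 / 2 + t * I))) := by
    intro t
    unfold weilMellin
    set bound : ℝ → ℝ := (Icc (-b') b').indicator fun _ => C₀ with hbound
    refine tendsto_integral_of_dominated_convergence bound (fun k => ?_) ?_ (fun k => ?_) ?_
    · exact ((hWt _).1.continuous.mul (by fun_prop)).aestronglyMeasurable
    · rw [hbound]
      exact (integrableOn_const (hs := by
        rw [Real.volume_Icc]; exact ENNReal.ofReal_ne_top)).integrable_indicator measurableSet_Icc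
    · refine Eventually.of_forall fun u => ?_
      rw [norm_mul, show (1 / 2 : ℂ) + t * I - 1 / 2 = ((u * t : ℝ) : ℂ) * I / u * 0 + t * I by ring]
      simp only [mul_zero, zero_add]
      rw [show (t : ℂ) * I * u = ((t * u : ℝ) : ℂ) * I by push_cast; ring,
        Complex.norm_exp_ofReal_mul_I, mul_one, hbound]
      by_cases hu : u ∈ Icc (-b') b'
      · rw [indicator_of_mem hu]; exact hC _ u
      · rw [indicator_of_notMem hu, hWzero _ u hu, norm_zero]
    · exact Eventually.of_forall fun u => ((hV u).mul tendsto_const_nhds)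
  -- the transforms are uniformly Lipschitz along the line
  have hint : ∀ k, ∫ u, ‖Ws k u‖ ≤ 2 * b' * C₀ := by
    intro k
    have h1 : ∫ u, ‖Ws k u‖ ≤ ∫ u, (Icc (-b') b').indicator (fun _ => C₀) u := by
      refine integral_mono_of_nonneg (Eventually.of_forall fun _ => norm_nonneg _)
        ((integrableOn_const (hs := by
          rw [Real.volume_Icc]; exact ENNReal.ofReal_ne_top)).integrable_indicator measurableSet_Icc)
        (Eventually.of_forall fun u => ?_)
      by_cases hu : u ∈ Icc (-b') b'
      · simp only [indicator_of_mem hu]; exact hC k u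
      · simp only [indicator_of_notMem hu, hWzero k u hu, norm_zero, le_refl]
    rw [integral_indicator_const _ measurableSet_Icc, Real.volume_real_Icc_of_le (by linarith),
      smul_eq_mul] at h1
    linarith
  -- the zeros of `V̂` at the limit points `μ n`
  have hzero : ∀ n, weilMellin V (1 / 2 + μ n * I) = 0 := by
    intro n
    refine tendsto_nhds_unique (hconv (μ n)) ?_
    rw [tendsto_zero_iff_norm_tendsto_zero]
    have hk : Tendsto (fun k : ℕ => Nφ / ((ψ k : ℕ) + 1 : ℝ)) atTop (𝓝 0) := by
      have h1 : Tendsto (fun k : ℕ => ((ψ k : ℕ) : ℝ) + 1) atTop atTop := by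
        refine tendsto_atTop_add_const_right _ _ ?_
        exact tendsto_natCast_atTop_atTop.comp hψ.tendsto_atTop
      exact tendsto_const_nhds.div_atTop h1
    have hΛμ : Tendsto (fun k => |μ n - Λs (ψ k) n| * b' * (2 * b' * C₀)) atTop (𝓝 0) := by
      have h1 : Tendsto (fun k => |μ n - Λs (ψ k) n|) atTop (𝓝 0) := by
        have := (tendsto_const_nhds (x := μ n)).sub (hμ n)
        rw [sub_self] at this
        simpa using this.abs
      simpa using (h1.mul_const b').mul_const (2 * b' * C₀)
    refine squeeze_zero (fun k => norm_nonneg _) (fun k => ?_) (by simpa using hk.add hΛμ)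
    have h1 := hWsmall (ψ k) n
    have h2 := norm_weilMellin_line_sub_le (hWt (ψ k)).1.continuous (hWt (ψ k)).2
      (hWsupp (ψ k)) (μ n) (Λs (ψ k) n)
    calc ‖weilMellin (Ws (ψ k)) (1 / 2 + μ n * I)‖
        ≤ ‖weilMellin (Ws (ψ k)) (1 / 2 + Λs (ψ k) n * I)‖ +
          ‖weilMellin (Ws (ψ k)) (1 / 2 + μ n * I) -
            weilMellin (Ws (ψ k)) (1 / 2 + Λs (ψ k) n * I)‖ := norm_le_insert' _ _
      _ ≤ Nφ / ((ψ k : ℕ) + 1 : ℝ) + |μ n - Λs (ψ k) n| * b' * (2 * b' * C₀) := by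
          refine add_le_add h1 (h2.trans ?_)
          exact mul_le_mul_of_nonneg_left (hint _) (by positivity)
  -- `V̂(1/2) ≠ 0`
  have hhalf : weilMellin V (1 / 2) ≠ 0 := by
    have h1 : Tendsto (fun k => ‖weilMellin (Ws (ψ k)) (1 / 2)‖) atTop
        (𝓝 ‖weilMellin V (1 / 2)‖) := by simpa using (hconv 0).norm
    have h2 : ‖weilMellin φ (1 / 2)‖ / 2 ≤ ‖weilMellin V (1 / 2)‖ :=
      ge_of_tendsto' h1 fun k => hWhalf (ψ k)
    have h3 : 0 < ‖weilMellin φ (1 / 2)‖ := norm_pos_iff.2 hφ0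
    intro h
    rw [h, norm_zero] at h2
    linarith
  -- `μ` is injective, of uniform density `d`
  have hμinj : Function.Injective μ := by
    intro m n hmn
    by_contra hne
    have h1 : s ≤ |μ m - μ n| :=
      ge_of_tendsto' (((hμ m).sub (hμ n)).abs) fun k => hΛsep (ψ k) hne
    rw [hmn, sub_self, abs_zero] at h1
    linarith
  have hμM : ∀ n, |μ n - n / d| ≤ M + 1 / d := by
    intro n
    have := hμmem n
    rw [mem_Icc] at this
    rw [abs_le]; constructor <;> linarith [this.1, this.2]
  -- contradiction with the density theorem
  exact hhalf (weilMellin_half_eq_zero_of_zeros_uniformDensity hVcont hVcs hd hbη hVsupp hμinj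
    hμM hzero)

end Literature.NumberTheory.LFunctions

end
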